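import Mathlib
import HarnessLib
import Summits.NavierStokesRegularity.NavierStokesRegularity.Theorems.UnthreadedRigidityDoorUnthreadedRigidityMixedPairWindowBalance
import Summits.NavierStokesRegularity.NavierStokesRegularity.Theorems.UnthreadedRigidityDoorUnthreadedRigidityMixedPairSphereTools
import Summits.NavierStokesRegularity.NavierStokesRegularity.Theorems.UnthreadedRigidityDoorUnthreadedRigidityPersistenceLambCurlIdentity

/-!
# Route `UnthreadedRigidityDoor`, item `UnthreadedRigidity` (W2, stmt-NavierStokesRegularity-27585) — LINE g11-2 «MIXED PAIR» meets
# LINE g12-2 «PERSISTENCE»: ★ THE PAIR SPHERE LAW — a toroidally balanced admissible pair has `b₂[H₂] ≡ 0`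

Prover file (engine-1 g73; `--supports stmt-NavierStokesRegularity-27585 --as helper`; route-independent imports).

THE POINT (two shells, first order in time — no second jet).  If an admissible pair `u = pairShell H₁ H₂ a Q x₀` is TOROIDALLY BALANCED OVER THE
PAIR WITH RADIAL COEFFICIENTS, `curl(ω × u)(x₀ + y) = e₁(|y|) (a × y) + e₂(|y|) (2Qy × y)` (which every slice of a pair WINDOW is:
`MixedPair.pair_window_toroidal_balance`, file `…MixedPairWindowBalance`), then the quadrupole profile satisfies the SINGLE-SHELL SPHERE LAW
`b₂[H₂] ≡ 0` on `(0,∞)`, `b₂[H] = (1/r)(K H′ − 3K′H)`, `K = vortAmpL 2 H` — verbatim the hypothesis of the tree's `Persistence.cubicLaw` (es-p1) —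
provided `Q ≠ 0`.  MECHANISM: by PARITY in `y` the cross terms `curl(ω₁ × u₂ + ω₂ × u₁)` are ODD (the dipole shell is even and its vorticity
odd, the quadrupole shell is odd and its vorticity even — three curls of an even/odd potential shell; the curl of an even field is odd), so the
EVEN part of the balance reads `∇ψ₁ × y + ∇ψ₂ × y = e₂(|y|) (2Qy × y)` with the single-shell Lamb-curl potentials `ψᵢ` of
`Persistence.singleShellLambCurlIdentity`; hence `ψ₁ + ψ₂ − e₂(r)·yᵀQy` is constant on each sphere `S_r`
(`Persistence.eq_of_cross_gradient_eq_zero_on_sphere`), i.e. on the unit sphere `b₂(r)r⁴·(uᵀQu)² =` a quadratic form in `u`; restricting to the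
three coordinate great circles, `binary_quartic_alternative` gives `b₂(r) = 0` unless `Q`'s three binary restrictions are multiples of the
identity form, which would make the traceless `Q` vanish (`eq_zero_of_coordinate_planes`).

Result: ★ `pair_sphereLaw_b₂`.  Consumer: `…MixedPairWindowRigidityHolds` (★★ `MixedPairWindowRigidity` unconditional: pair windows are empty).

HONEST LABEL: vector calculus of explicit SPECIAL two-shell data (support of a rung line); nothing here bears on `UnthreadedRigidity` (27585),
the door Target, W2 or Navier–Stokes regularity; no summit statement is proved.  MODEL/rung work; 0 kit.
-/

noncomputable section

-- the summit and its single sub-problem share the name (CONVENTIONS §1), as in every Theorems file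
set_option linter.dupNamespace false

namespace Summit.NavierStokesRegularity.NavierStokesRegularity.Theorems.UnthreadedRigidity.MixedPair

open Set Function Filter Topology
open scoped RealInnerProductSpace ContDiff
open Literature.Analysis Literature.Analysis.FluidPDE
open Summit.NavierStokesRegularity.NavierStokesRegularity.Theorems.UnthreadedRigidity.ProfileHorn (E3)
open Summit.NavierStokesRegularity.NavierStokesRegularity.Theorems.UnthreadedRigidity.VirialHorn
  (e IsSolidHarmonic VirialAdmissible sepShellL vortAmpL strainAmpL sepShellL_eq_comp_sub curl_comp_sub_const_fun contDiff_shell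
    contDiff_top_sepShellL curl_curl_shell_apply curl_shell_eq)
open Summit.NavierStokesRegularity.NavierStokesRegularity.Theorems.UnthreadedRigidity.Persistence (singleShellLambCurlIdentity
  eq_of_cross_gradient_eq_zero_on_sphere differentiableAt_lambPot)

/-! ## §5 ★ The pair sphere law -/

section SphereLaw

/-- ★ **THE PAIR SPHERE LAW**: an admissible pair with `Q ≠ 0`, TOROIDALLY BALANCED OVER THE PAIR WITH RADIAL COEFFICIENTS, has `b₂[H₂] ≡ 0` on
`(0,∞)` — in the exact form consumed by `Persistence.cubicLaw` (module docstring). -/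
theorem pair_sphereLaw_b₂ {H₁ H₂ : ℝ → ℝ} {a : E3} {Q : E3 →L[ℝ] E3} (hadm : PairAdmissible H₁ H₂ a Q) (hQ0 : Q ≠ 0) (x₀ : E3)
    (hbal : ∃ e₁ e₂ : ℝ → ℝ, ∀ y : E3,
      curl (fun x => cross (curl (pairShell H₁ H₂ a Q x₀) x) (pairShell H₁ H₂ a Q x₀ x)) (x₀ + y) =
        e₁ ‖y‖ • cross (gradient (dipoleHarmonic a) y) y + e₂ ‖y‖ • cross (gradient (quadHarmonic Q) y) y) :
    ∀ r : ℝ, 0 < r →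
      ((2 : ℕ) : ℝ) / (2 * r) * ((((2 : ℕ) : ℝ) - 1) * vortAmpL 2 H₂ r * deriv H₂ r
        - (((2 : ℕ) : ℝ) + 1) * deriv (vortAmpL 2 H₂) r * H₂ r) = 0 := by
  obtain ⟨e₁, e₂, hbal⟩ := hbal
  obtain ⟨ha0, hQts, hV₁, hV₂⟩ := hadm
  have hQ : ∀ p q : E3, ⟪Q p, q⟫ = ⟪p, Q q⟫ := hQts.1
  have hY₁ : IsSolidHarmonic 1 (dipoleHarmonic a) := isSolidHarmonic_dipoleHarmonic a
  have hY₂ : IsSolidHarmonic 2 (quadHarmonic Q) := isSolidHarmonic_quadHarmonic hQts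
  set Y₁ : E3 → ℝ := dipoleHarmonic a with hY₁_def
  set Y₂ : E3 → ℝ := quadHarmonic Q with hY₂_def
  have hY₁d : Differentiable ℝ Y₁ := hY₁.contDiff.differentiable (by simp)
  have hY₂d : Differentiable ℝ Y₂ := hY₂.contDiff.differentiable (by simp)
  -- the two shells, centred, and their parities
  obtain ⟨h₁, hh₁, hHh₁⟩ := hV₁.1
  obtain ⟨h₂, hh₂, hHh₂⟩ := hV₂.1
  set sh₁ : E3 → E3 := fun z => (h₁ (‖z‖ ^ 2) * Y₁ z) • z with hsh₁
  set sh₂ : E3 → E3 := fun z => (h₂ (‖z‖ ^ 2) * Y₂ z) • z with hsh₂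
  have hsh₁s : ContDiff ℝ (⊤ : ℕ∞) sh₁ := contDiff_shell hh₁ hY₁
  have hsh₂s : ContDiff ℝ (⊤ : ℕ∞) sh₂ := contDiff_shell hh₂ hY₂
  set P₁ : E3 → E3 := curl (curl sh₁) with hP₁
  set P₂ : E3 → E3 := curl (curl sh₂) with hP₂
  have hc1 : ContDiff ℝ (⊤ : ℕ∞) (curl sh₁) := contDiff_curl (n := ⊤) (by simpa using hsh₁s)
  have hc2 : ContDiff ℝ (⊤ : ℕ∞) (curl sh₂) := contDiff_curl (n := ⊤) (by simpa using hsh₂s)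
  have hP₁s : ContDiff ℝ (⊤ : ℕ∞) P₁ := contDiff_curl (n := ⊤) (by simpa using hc1)
  have hP₂s : ContDiff ℝ (⊤ : ℕ∞) P₂ := contDiff_curl (n := ⊤) (by simpa using hc2)
  have hω₁s : ContDiff ℝ (⊤ : ℕ∞) (curl P₁) := contDiff_curl (n := ⊤) (by simpa using hP₁s)
  have hω₂s : ContDiff ℝ (⊤ : ℕ∞) (curl P₂) := contDiff_curl (n := ⊤) (by simpa using hP₂s)
  have hP₁d : Differentiable ℝ P₁ := hP₁s.differentiable (by simp)
  have hP₂d : Differentiable ℝ P₂ := hP₂s.differentiable (by simp)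
  have hω₁d : Differentiable ℝ (curl P₁) := hω₁s.differentiable (by simp)
  have hω₂d : Differentiable ℝ (curl P₂) := hω₂s.differentiable (by simp)
  -- parities: `sh₁` even ⇒ `curl sh₁` odd ⇒ `P₁` even ⇒ `ω₁` odd; `sh₂` odd ⇒ … ⇒ `P₂` odd ⇒ `ω₂` even
  have hsh₁e : ∀ z : E3, sh₁ (-z) = sh₁ z := fun z => dipoleShell_even h₁ a z
  have hsh₂o : ∀ z : E3, sh₂ (-z) = -sh₂ z := fun z => quadShell_odd h₂ Q z
  have hcs₁o : ∀ z : E3, curl sh₁ (-z) = -curl sh₁ z := curl_neg_of_even (hsh₁s.differentiable (by simp)) hsh₁e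
  have hcs₂e : ∀ z : E3, curl sh₂ (-z) = curl sh₂ z := curl_neg_of_odd (hsh₂s.differentiable (by simp)) hsh₂o
  have hP₁e : ∀ z : E3, P₁ (-z) = P₁ z := curl_neg_of_odd (hc1.differentiable (by simp)) hcs₁o
  have hP₂o : ∀ z : E3, P₂ (-z) = -P₂ z := curl_neg_of_even (hc2.differentiable (by simp)) hcs₂e
  have hω₁o : ∀ z : E3, curl P₁ (-z) = -curl P₁ z := curl_neg_of_even hP₁d hP₁e
  have hω₂e : ∀ z : E3, curl P₂ (-z) = curl P₂ z := curl_neg_of_odd hP₂d hP₂o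
  -- the slice and its vorticity are translates
  set S₁ : E3 → E3 := sepShellL H₁ Y₁ x₀ with hS₁
  set S₂ : E3 → E3 := sepShellL H₂ Y₂ x₀ with hS₂
  have hS₁e : S₁ = fun x => P₁ (x - x₀) := by rw [hS₁, sepShellL_eq_comp_sub hHh₁ Y₁ x₀]
  have hS₂e : S₂ = fun x => P₂ (x - x₀) := by rw [hS₂, sepShellL_eq_comp_sub hHh₂ Y₂ x₀]
  have hωS₁ : curl S₁ = fun x => curl P₁ (x - x₀) := by rw [hS₁e, curl_comp_sub_const_fun]
  have hωS₂ : curl S₂ = fun x => curl P₂ (x - x₀) := by rw [hS₂e, curl_comp_sub_const_fun]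
  have hS₁d : Differentiable ℝ S₁ := by rw [hS₁e]; exact fun x => (hP₁d _).comp x (differentiableAt_id.sub_const x₀)
  have hS₂d : Differentiable ℝ S₂ := by rw [hS₂e]; exact fun x => (hP₂d _).comp x (differentiableAt_id.sub_const x₀)
  have hcS₁d : Differentiable ℝ (curl S₁) := by
    rw [hωS₁]; exact fun x => (hω₁d _).comp x (differentiableAt_id.sub_const x₀)
  have hcS₂d : Differentiable ℝ (curl S₂) := by
    rw [hωS₂]; exact fun x => (hω₂d _).comp x (differentiableAt_id.sub_const x₀)
  have hu : pairShell H₁ H₂ a Q x₀ = fun x => S₁ x + S₂ x := rfl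
  have hcurlu : curl (pairShell H₁ H₂ a Q x₀) = fun x => curl S₁ x + curl S₂ x := by
    funext x; rw [hu]; exact curl_add (hS₁d x) (hS₂d x)
  -- the Lamb vector field splits: self terms + cross terms
  set X : E3 → E3 := fun x => cross (curl S₁ x) (S₂ x) + cross (curl S₂ x) (S₁ x) with hX
  have hadd_l : ∀ p q m : E3, cross (p + q) m = cross p m + cross q m := fun p q m => by
    rw [← crossCLM_apply (p + q) m, map_add]; rfl
  have hadd_r : ∀ p m n : E3, cross p (m + n) = cross p m + cross p n := fun p m n => by
    rw [← crossCLM_apply p (m + n), map_add, crossCLM_apply, crossCLM_apply]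
  have hLamb : (fun x => cross (curl (pairShell H₁ H₂ a Q x₀) x) (pairShell H₁ H₂ a Q x₀ x)) =
      fun x => (cross (curl S₁ x) (S₁ x) + cross (curl S₂ x) (S₂ x)) + X x := by
    funext x
    rw [hcurlu, hu, hX]
    simp only [hadd_l, hadd_r]
    abel
  -- differentiability of the pieces
  have hdc : ∀ {f g : E3 → E3}, Differentiable ℝ f → Differentiable ℝ g → Differentiable ℝ (fun x => cross (f x) (g x)) :=
    fun hf hg x => (hasFDerivAt_cross (hf x).hasFDerivAt (hg x).hasFDerivAt).differentiableAt
  have hL₁d : Differentiable ℝ (fun x => cross (curl S₁ x) (S₁ x)) := hdc hcS₁d hS₁d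
  have hL₂d : Differentiable ℝ (fun x => cross (curl S₂ x) (S₂ x)) := hdc hcS₂d hS₂d
  have hXd : Differentiable ℝ X := by rw [hX]; exact (hdc hcS₁d hS₂d).add (hdc hcS₂d hS₁d)
  -- the cross term is EVEN about `x₀`, so its curl is ODD
  set Xc : E3 → E3 := fun y => X (x₀ + y) with hXc
  have hXc_eval : ∀ z : E3, Xc z = cross (curl P₁ z) (P₂ z) + cross (curl P₂ z) (P₁ z) := by
    intro z
    simp only [hXc, hX]
    rw [hωS₁, hωS₂, hS₁e, hS₂e]
    simp only [add_sub_cancel_left]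
  have hXce : ∀ y : E3, Xc (-y) = Xc y := by
    intro y
    rw [hXc_eval, hXc_eval, hω₁o, hP₂o, hω₂e, hP₁e, cross_neg_neg]
  have hXcd : Differentiable ℝ Xc := fun y => (hXd _).comp y ((differentiableAt_const x₀).add differentiableAt_id)
  have hXtr : X = fun x => Xc (x - x₀) := by funext x; simp [hXc]
  have hcurlX : ∀ y : E3, curl X (x₀ + y) = curl Xc y := by
    intro y; rw [hXtr, curl_comp_sub_const_fun]; simp only [add_sub_cancel_left]
  have hcurlXo : ∀ y : E3, curl Xc (-y) = -curl Xc y := curl_neg_of_even hXcd hXce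
  -- the self terms by the single-shell Lamb-curl identity
  set ψ₁ : E3 → ℝ := fun y => -(vortAmpL 1 H₁ ‖y‖ * strainAmpL 1 H₁ ‖y‖) * ‖gradient Y₁ y‖ ^ 2
      + (1 : ℝ) / (2 * ‖y‖) * (((1 : ℝ) - 1) * vortAmpL 1 H₁ ‖y‖ * deriv H₁ ‖y‖
          - ((1 : ℝ) + 1) * deriv (vortAmpL 1 H₁) ‖y‖ * H₁ ‖y‖) * Y₁ y ^ 2 with hψ₁
  set ψ₂ : E3 → ℝ := fun y => -(vortAmpL 2 H₂ ‖y‖ * strainAmpL 2 H₂ ‖y‖) * ‖gradient Y₂ y‖ ^ 2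
      + (2 : ℝ) / (2 * ‖y‖) * (((2 : ℝ) - 1) * vortAmpL 2 H₂ ‖y‖ * deriv H₂ ‖y‖
          - ((2 : ℝ) + 1) * deriv (vortAmpL 2 H₂) ‖y‖ * H₂ ‖y‖) * Y₂ y ^ 2 with hψ₂
  have hA₁ : ∀ y : E3, y ≠ 0 → curl (fun x => cross (curl S₁ x) (S₁ x)) (x₀ + y) = cross (gradient ψ₁ y) y := by
    intro y hy
    have h := singleShellLambCurlIdentity 1 H₁ Y₁ x₀ le_rfl hY₁ hV₁ y hy
    rw [hψ₁]; push_cast at h ⊢; exact h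
  have hA₂ : ∀ y : E3, y ≠ 0 → curl (fun x => cross (curl S₂ x) (S₂ x)) (x₀ + y) = cross (gradient ψ₂ y) y := by
    intro y hy
    have h := singleShellLambCurlIdentity 2 H₂ Y₂ x₀ (by norm_num) hY₂ hV₂ y hy
    rw [hψ₂]; push_cast at h ⊢; exact h
  -- `ψᵢ` are even
  have hgY₁ : ∀ y : E3, gradient Y₁ (-y) = gradient Y₁ y := fun y => by
    rw [hY₁_def, gradient_dipoleHarmonic]
  have hgY₂ : ∀ y : E3, gradient Y₂ (-y) = -gradient Y₂ y := fun y => by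
    rw [hY₂_def, gradient_quadHarmonic hQ]; simp
  have hY₁n : ∀ y : E3, Y₁ (-y) = -Y₁ y := fun y => by simp [hY₁_def, dipoleHarmonic, inner_neg_right]
  have hY₂n : ∀ y : E3, Y₂ (-y) = Y₂ y := fun y => by simp [hY₂_def, quadHarmonic, inner_neg_left, inner_neg_right]
  have hψ₁e : ∀ y : E3, ψ₁ (-y) = ψ₁ y := fun y => by simp only [hψ₁, norm_neg, hgY₁, hY₁n, neg_sq]
  have hψ₂e : ∀ y : E3, ψ₂ (-y) = ψ₂ y := fun y => by simp only [hψ₂, norm_neg, hgY₂, norm_neg, hY₂n]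
  have hψ₁d : ∀ y : E3, y ≠ 0 → DifferentiableAt ℝ ψ₁ y := fun y hy => by
    have h := differentiableAt_lambPot 1 hV₁ hY₁ hy
    rw [hψ₁]; push_cast at h ⊢; exact h
  have hψ₂d : ∀ y : E3, y ≠ 0 → DifferentiableAt ℝ ψ₂ y := fun y hy => by
    have h := differentiableAt_lambPot 2 hV₂ hY₂ hy
    rw [hψ₂]; push_cast at h ⊢; exact h
  -- THE EVEN PART OF THE BALANCE: `∇ψ₁ × y + ∇ψ₂ × y = e₂(|y|) ∇Y₂ × y`
  have hsplit : ∀ z : E3, curl (fun x => (cross (curl S₁ x) (S₁ x) + cross (curl S₂ x) (S₂ x)) + X x) z =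
      curl (fun x => cross (curl S₁ x) (S₁ x)) z + curl (fun x => cross (curl S₂ x) (S₂ x)) z + curl X z := by
    intro z
    have h1 : DifferentiableAt ℝ (fun x => cross (curl S₁ x) (S₁ x) + cross (curl S₂ x) (S₂ x)) z :=
      (hL₁d z).add (hL₂d z)
    rw [curl_add h1 (hXd z), curl_add (hL₁d z) (hL₂d z)]
  have heven : ∀ y : E3, y ≠ 0 → cross (gradient ψ₁ y) y + cross (gradient ψ₂ y) y = e₂ ‖y‖ • cross (gradient Y₂ y) y := by
    intro y hy
    have hy' : -y ≠ 0 := neg_ne_zero.2 hy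
    -- the balance at `y` and at `−y`, with all pieces evaluated
    have hb : cross (gradient ψ₁ y) y + cross (gradient ψ₂ y) y + curl Xc y =
        e₁ ‖y‖ • cross (gradient Y₁ y) y + e₂ ‖y‖ • cross (gradient Y₂ y) y := by
      have h := hbal y
      rwa [hLamb, hsplit, hA₁ y hy, hA₂ y hy, hcurlX] at h
    have hb' : cross (gradient ψ₁ y) y + cross (gradient ψ₂ y) y - curl Xc y =
        -(e₁ ‖y‖ • cross (gradient Y₁ y) y) + e₂ ‖y‖ • cross (gradient Y₂ y) y := by
      have h := hbal (-y)
      rw [hLamb, hsplit, hA₁ (-y) hy', hA₂ (-y) hy', hcurlX, hcurlXo, norm_neg, gradient_at_neg_of_even hψ₁e (hψ₁d y hy),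
        gradient_at_neg_of_even hψ₂e (hψ₂d y hy), cross_neg_neg, cross_neg_neg, cross_gradient_dipoleHarmonic_neg,
        cross_gradient_quadHarmonic_neg hQ, smul_neg, ← sub_eq_add_neg] at h
      exact h
    have hsum := congrArg₂ (· + ·) hb hb'
    have h2 : (2 : ℝ) • (cross (gradient ψ₁ y) y + cross (gradient ψ₂ y) y) = (2 : ℝ) • (e₂ ‖y‖ • cross (gradient Y₂ y) y) := by
      rw [two_smul, two_smul]
      convert hsum using 1 <;> abel
    exact smul_right_injective E3 (two_ne_zero) h2
  -- ON EACH SPHERE `ψ₁ + ψ₂ − e₂(r) Y₂` IS CONSTANT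
  intro r hr
  set F : E3 → ℝ := fun y => ψ₁ y + ψ₂ y - e₂ r * Y₂ y with hF
  have hFd : ∀ y : E3, ‖y‖ = r → DifferentiableAt ℝ F y := fun y hy => by
    have hy0 : y ≠ 0 := by rw [← norm_ne_zero_iff, hy]; exact hr.ne'
    exact ((hψ₁d y hy0).add (hψ₂d y hy0)).sub ((hY₂d y).const_mul _)
  have hFrad : ∀ y : E3, ‖y‖ = r → cross (gradient F y) y = 0 := by
    intro y hy
    have hy0 : y ≠ 0 := by rw [← norm_ne_zero_iff, hy]; exact hr.ne'
    have hgrad : gradient F y = gradient ψ₁ y + gradient ψ₂ y - (e₂ r) • gradient Y₂ y := by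
      have hd12 : DifferentiableAt ℝ (fun z => ψ₁ z + ψ₂ z) y := (hψ₁d y hy0).add (hψ₂d y hy0)
      have hd3 : DifferentiableAt ℝ (fun z => e₂ r * Y₂ z) y := (hY₂d y).const_mul _
      rw [hF, gradient, fderiv_fun_sub hd12 hd3, fderiv_fun_add (hψ₁d y hy0) (hψ₂d y hy0), fderiv_const_mul (hY₂d y),
        map_sub, map_add, map_smul]
      rfl
    have hlin : cross (gradient ψ₁ y + gradient ψ₂ y - (e₂ r) • gradient Y₂ y) y =
        cross (gradient ψ₁ y) y + cross (gradient ψ₂ y) y - (e₂ r) • cross (gradient Y₂ y) y := by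
      rw [← crossCLM_apply (gradient ψ₁ y + gradient ψ₂ y - (e₂ r) • gradient Y₂ y) y, map_sub, map_add, map_smul]
      rfl
    rw [hgrad, hlin, heven y hy0, hy, sub_self]
  -- transport to the unit sphere: `N (uᵀQu)² = quadratic form in u`
  have hru : ∀ u : E3, ‖u‖ = 1 → ‖(r : ℝ) • u‖ = r := fun u hu => by
    rw [norm_smul, Real.norm_eq_abs, abs_of_pos hr, hu, mul_one]
  set N : ℝ := ((2 : ℝ) / (2 * r) * (((2 : ℝ) - 1) * vortAmpL 2 H₂ r * deriv H₂ r
      - ((2 : ℝ) + 1) * deriv (vortAmpL 2 H₂) r * H₂ r)) * r ^ 4 with hN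
  set β₁ : ℝ := ((1 : ℝ) / (2 * r) * (((1 : ℝ) - 1) * vortAmpL 1 H₁ r * deriv H₁ r
      - ((1 : ℝ) + 1) * deriv (vortAmpL 1 H₁) r * H₁ r)) * r ^ 2 with hβ₁
  set β₂ : ℝ := -(vortAmpL 2 H₂ r * strainAmpL 2 H₂ r) * (4 * r ^ 2) with hβ₂
  set β₃ : ℝ := e₂ r * r ^ 2 with hβ₃
  set C₀ : ℝ := -(vortAmpL 1 H₁ r * strainAmpL 1 H₁ r) * ‖a‖ ^ 2 with hC₀
  have hval : ∀ u : E3, ‖u‖ = 1 →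
      F (r • u) = C₀ + β₁ * ⟪a, u⟫ ^ 2 + β₂ * ‖Q u‖ ^ 2 + N * ⟪Q u, u⟫ ^ 2 - β₃ * ⟪Q u, u⟫ := by
    intro u hu
    have hY₁s : Y₁ (r • u) = r * ⟪a, u⟫ := by simp [hY₁_def, dipoleHarmonic, real_inner_smul_right]
    have hY₂s : Y₂ (r • u) = r ^ 2 * ⟪Q u, u⟫ := by
      simp [hY₂_def, quadHarmonic, map_smul, real_inner_smul_left, real_inner_smul_right]; ring
    have hg₁ : ‖gradient Y₁ (r • u)‖ ^ 2 = ‖a‖ ^ 2 := by rw [hY₁_def, gradient_dipoleHarmonic]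
    have hg₂ : ‖gradient Y₂ (r • u)‖ ^ 2 = 4 * r ^ 2 * ‖Q u‖ ^ 2 := by
      rw [hY₂_def, gradient_quadHarmonic hQ]
      simp only [map_smul, smul_smul, norm_smul, Real.norm_eq_abs, mul_pow, sq_abs]
      ring
    simp only [hF, hψ₁, hψ₂, hru u hu, hY₁s, hY₂s, hg₁, hg₂, hN, hβ₁, hβ₂, hβ₃, hC₀]
    ring
  have norm_e : ∀ i : Fin 3, ‖e i‖ = 1 := fun i => by simp [e]
  obtain ⟨C, hC⟩ : ∃ C : ℝ, ∀ u : E3, ‖u‖ = 1 → F (r • u) = C := by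
    refine ⟨F (r • e 0), fun u hu => ?_⟩
    exact eq_of_cross_gradient_eq_zero_on_sphere hr hFd hFrad (hru u hu) (hru (e 0) (norm_e 0))
  -- binary restriction to an orthonormal pair `(v, w)`
  have hpair : ∀ v w : E3, ‖v‖ = 1 → ‖w‖ = 1 → ⟪v, w⟫ = 0 →
      N = 0 ∨ (⟪Q v, v⟫ = ⟪Q w, w⟫ ∧ ⟪Q v, w⟫ = 0) := by
    intro v w hv hw hvw
    refine binary_quartic_alternative (l₁ := C - C₀ - β₁ * ⟪a, v⟫ ^ 2 - β₂ * ‖Q v‖ ^ 2 + β₃ * ⟪Q v, v⟫)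
      (l₂ := -β₁ * (⟪a, v⟫ * ⟪a, w⟫) - β₂ * ⟪Q v, Q w⟫ + β₃ * ⟪Q v, w⟫)
      (l₃ := C - C₀ - β₁ * ⟪a, w⟫ ^ 2 - β₂ * ‖Q w‖ ^ 2 + β₃ * ⟪Q w, w⟫) (fun c s hcs => ?_)
    have hu1 : ‖c • v + s • w‖ = 1 := norm_orthonormal_pair hv hw hvw hcs
    have h := (hval (c • v + s • w) hu1).symm.trans (hC (c • v + s • w) hu1)
    rw [inner_apply_pair hQ, inner_sq_pair, norm_sq_apply_pair] at h
    linear_combination h - (C - C₀) * hcs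
  -- the three coordinate planes
  have e01 := hpair (e 0) (e 1) (norm_e 0) (norm_e 1) (by rw [inner_e_e]; simp)
  have e02 := hpair (e 0) (e 2) (norm_e 0) (norm_e 2) (by rw [inner_e_e]; simp)
  have e12 := hpair (e 1) (e 2) (norm_e 1) (norm_e 2) (by rw [inner_e_e]; simp)
  have hN0 : N = 0 := by
    by_contra hN0
    exact hQ0 (eq_zero_of_coordinate_planes hQts (e01.resolve_left hN0) (e02.resolve_left hN0) (e12.resolve_left hN0))
  have hr4 : r ^ 4 ≠ 0 := pow_ne_zero 4 hr.ne'
  have := (mul_eq_zero.1 hN0).resolve_right hr4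
  push_cast
  exact this

end SphereLaw

end Summit.NavierStokesRegularity.NavierStokesRegularity.Theorems.UnthreadedRigidity.MixedPair

end
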